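import Summits.QuantumFields.BalabanUV.T4Continuum.Support.U3PolymerDictionaryRecord
import Summits.QuantumFields.BalabanUV.T4Continuum.Support.U3PolymerDictionaryLift
import Literature.MathematicalPhysics.QuantumFieldTheory.Balaban1983to89.T4HistoryLipschitzOuter

/-!
# U3PolymerDictionaryNE9Face — the NE9 READING OF RECORD of the U3 `act` slot typed once: background slot FREE (a background,
# not an operator datum), table slot feeding BOTH the operator datum and the inserted history, last coupling explicit; NE9's
# outer binder `Factorises` INHABITED for NE5's functional of record at the background slot under the data factorisation D-6

Cell `pub-balaban`, BINDER row NE9 OWNER lineage `b2b-balaban-t4-ne9-p1` (gen 28, prover-b2b-balaban-t4-ne9-p1-g28-0): the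
owner's one-generation SHAPE REVIEW of `substrate/SUBSTRATE-MAP.md` v0.2 §O1 (ruling Q-NE9-O1 (d)) and answer to Q-S3, kernel
part (prose part: `t4/b2b-balaban-t4-ne9-p1/g28/SHAPE-REVIEW-NE9-g28.md`).  Summits-side bookkeeping under the LEAN PLACEMENT RULE;
the imported modules are used BY NAME and not edited; 0 estimate; no `def … : Prop`; nothing printed is asserted.

HONEST FRAMING (T4-DAG p. 1).  Rung (B)+1 of the FINITE-VOLUME T⁴ continuum programme — NOT infinite volume, NOT a mass gap, NOT
the Clay problem, NOT a proof of NE5 or NE9 (neither is PRINTED in [Balaban1987RG1]–[Balaban1989LargeFieldII]; spine PROVED 0∕9;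
0∕18 NE9 leaves instantiated on Bałaban's objects).  HONEST DEPENDENCY (cell line, verbatim): continuum YM on T⁴ ⇐ BetaPertH ∧ nine
spine estimates (0/9 proved); BetaPertH ⇐ (D1) ∧ (D4) ∧ CAP+tail; G-an2-4 gates asym, D1 and NE2/3/4.  `FlowStep.BetaPertH`, (B),
(B^μ) do not occur.

WHY THIS FILE.  Row NE9's END of record (`NE9SizeFedCouplingSpeciesReadOut.termSize_ne9_and_fadingMemory_species_margProj_fedA3`,
p216114) concludes `T4OutputRate.NE9 Ef W κ Λ` — a bound on `|Ef g U X − Ef g′ U X|` for two coupling HISTORIES `g, g′` at ONE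
background `U` — from binders over an activity `act : ℕ → ℝ → E → Pot → G.P → ℂ` whose arguments are (step `k`, LAST coupling
`s = g k`, background `U`, TABLE `Q`, polymer): every dependence on `g₀, …, g_{k−1}` sits in the table slot (fed by the recursion,
`Factorises` ∕ `hreprV` with a `g`-independent reading `ρ k`), the last coupling is the scalar `s`, and the background slot is
`g`-INDEPENDENT (WALL-NE9-P1 §3 (i) ∕ §4 (e)).  The substrate's `U3PolymerDictionaryRecord` §2 reads NE9's background slot as NE5's
OPERATOR DATUM `OpDatum E` and NE9's table as NE5's `Hist`.  In Bałaban's step the operator datum of record `opB g U k` is NOT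
`g`-independent: of the five species of `B13OpDatum.Species` the three Gaussian kernels (`cov`, `deltaKer`, `gammaConstituent`:
C^{(k)}(U) = (C*Δ^{(k)}C)⁻¹ after the scaling B = g_k B′, [I] (2.12) p. 268) are coupling-free, but the two potential read-outs
`potQ` = Q(Y, B; b, b′) and `potR` = the operator part of 𝐕″_k(Y, ·) ([II] Lemma 2 (1.41)–(1.43) p. 11) are built from
F^{(k)}(g_k, U, B) AND from the earlier action {E_k(U_k(exp i·)) − E_k(U_k)} = Σ_Y 𝐕′_k(Y, ·) ([II] Lemma 1 (1.33)–(1.36) p. 9),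
i.e. they depend on the last coupling AND on the history.  NE9 at a FIXED operator datum is therefore not NE9 at a fixed background
(§3 records the logical gap by a two-line witness), and `NE9ComplexEncoding.ne9_comap` pulls back only along `g`-INDEPENDENT background
maps.  THE NE9 READING OF RECORD (this file, §1): `actNE9 S oRec iRec k s U Q` := the lift (`U3PolymerDictionaryLift.liftFam`) of
`Z ↦ activity (b13InnerData R) S.act (k + 1) (oRec k s U Q) (iRec k s U Q) Z` for SOURCING MAPS `oRec : ℕ → ℝ → Bg → Pot → OpDatum E`
(operator datum from last coupling, background, table) and `iRec : ℕ → ℝ → Bg → Pot → Hist` (inserted history likewise) — NE9's step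
label `k` is NE5's output scale `k + 1` ([I] (2.13) p. 268: E^{(k+1)} is produced by the k-th step at coupling g_k).
* §1 `newTerm_actNE9`: NE9's new term of `actNE9` on `(cubeChart R).geom` IS NE5's KP-form output of record
  `(kpStep S E₀ cB).Out (k + 1) (oRec k s U Q) (iRec k s U Q) X` — `U3PolymerDictionaryRecord.newTerm_eq_kpStep_Out`'s content at the
  NE9 reading (the act slot typed once still serves both rows; only the SLOT READING is fixed here).
* §2 `factorises_outB_KP_of_dataFactor`: under the DISPLAYED data factorisation of record — the [dict] line **D-6** this review asks
  of S-U3 ∕ `SubstrateRawSpecies`: `opB g U (k + 1) = oRec k (g k) U (tableB EB g U)` and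
  `insB g U (k + 1) (tableB EB g U) = iRec k (g k) U (tableB EB g U)` on the window (the step's data depend on the coupling sequence
  ONLY through the last coupling and the table of earlier outputs) — NE5's functional of record `outB_KP S E₀ cB` satisfies NE9's
  outer binder `T4HistoryLipschitzOuter.Factorises` with BACKGROUND slot `R.carriers.BgB`, the `g`-INDEPENDENT channel «the earlier
  table» and the new-term map `Ψ k s Q U X := (newTerm (actNE9 S oRec iRec) k s U X (Q at U)).re`.  With D-6 the END's two-point
  binders (`hCup`: two last couplings at one background and one table; `hKP`: two tables at one coupling and one background) are
  statements about Bałaban's data; without it they are not.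
* §3 `not_ne9_of_datum_jump`: NE9 at a fixed datum with zero history moduli, composed with a datum map that JUMPS in `g 0`, violates
  NE9 at the background for EVERY modulus family — the `OpDatum` reading relocates all of NE9's content into the history-regularity
  of the datum map (for Bałaban's potentials: an NE9-type estimate for 𝐕_k, which the recursion supplies ONLY through the table slot).
DISGUISE TEST: §1–§2 are identities ∕ a structural binder inhabited BY CONSTRUCTION under displayed hypotheses; §3 is a toy on a
one-domain carrier; nothing is NE9, nothing is an estimate.

References (TYPES ∕ loci only): [Balaban1987RG1] T. Bałaban, CMP **109** (1987) 249–301, (2.10)–(2.13) pp. 267–268, p. 256;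
[Balaban1988RG2Cluster] T. Bałaban, CMP **116** (1988) 1–22, Lemma 1 (1.33)–(1.36) p. 9, Lemma 2 (1.41)–(1.43) p. 11, (2.13)–(2.14)
pp. 14–15.
-/

noncomputable section

open scoped BigOperators

namespace Summit.QuantumFields.BalabanUV.T4Continuum.U3PolymerDictionaryNE9Face

open Literature.Probability.LatticeModels (truncatedWeight)
open Literature.MathematicalPhysics.QuantumFieldTheory.Balaban1983to89
open Literature.MathematicalPhysics.QuantumFieldTheory.Balaban1983to89.T4OutputRate (Carriers Functional NE9 Window)
open Literature.MathematicalPhysics.QuantumFieldTheory.Balaban1983to89.T4InputCauchyRateData (StepModel tableB)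
open Literature.MathematicalPhysics.QuantumFieldTheory.Balaban1983to89.T4HistoryLipschitzOuter (Factorises)
open Literature.MathematicalPhysics.QuantumFieldTheory.Balaban1983to89.T4ActivityLipschitz (clusterSum)
open Literature.MathematicalPhysics.QuantumFieldTheory.Balaban1983to89.T4HistoryLipschitzActivity (ClusterGeom)
open Summit.QuantumFields.BalabanUV.T4Continuum.B13Carriers (TwoRuns)
open Summit.QuantumFields.BalabanUV.T4Continuum.B13DomainGeometryTR (SCube footprint domainGeometry)
open Summit.QuantumFields.BalabanUV.T4Continuum.B13CarriersCubeChart (cubeChart)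
open Summit.QuantumFields.BalabanUV.T4Continuum.B13StepTermSocket (touchInc)
open Summit.QuantumFields.BalabanUV.T4Continuum.B13InnerData (b13InnerData Bnd)
open Summit.QuantumFields.BalabanUV.T4Continuum.B13OpDatum (OpDatum)
open Summit.QuantumFields.BalabanUV.T4Continuum.B13StepOfRecord (Slots step)
open Summit.QuantumFields.BalabanUV.T4Continuum.B13OutKPForm (activity)
open Summit.QuantumFields.BalabanUV.T4Continuum.B13KPStepOfRecord (kpStep kpStep_Out kpStep_opB kpStep_insB outB_KP representsB_kp)
open Summit.QuantumFields.BalabanUV.T4Continuum.U3PolymerDictionary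
open Summit.QuantumFields.BalabanUV.T4Continuum.U3PolymerDictionaryLift (liftFam liftAct_footprint newTerm_liftFam)

variable {G : Type} [GaugeGroup G] {R : TwoRuns G} {E : Type} {IOp Hist : Type*} [NormedAddCommGroup Hist] [NormedSpace ℂ Hist]
  (S : Slots R E IOp Hist) (E₀ cB : ℝ)

/-! ## §1 The NE9 reading of record of the `act` slot typed once -/

/-- [folklore] DATA (no inequality inside): **NE9's ACTIVITY OF RECORD READING NE5's `act` SLOT** — arguments (NE9 step label `k`,
LAST coupling `s`, background `U : Bg`, TABLE `Q : Pot`, cube family); the operator datum and the inserted history the slot reads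
are SOURCED from `(k, s, U, Q)` by `oRec` ∕ `iRec`; NE9's step `k` reads NE5's inner labels at the output scale `k + 1`; the lift
vanishes off footprints (`U3PolymerDictionaryLift.liftFam`). -/
def actNE9 {Bg : Type} {Pot : Type*} (oRec : ℕ → ℝ → Bg → Pot → OpDatum E) (iRec : ℕ → ℝ → Bg → Pot → Hist) :
    ℕ → ℝ → Bg → Pot → Finset (SCube R) → ℂ :=
  liftFam fun k s U Q => activity (b13InnerData R) S.act (k + 1) (oRec k s U Q) (iRec k s U Q)

variable {S} in
/-- [folklore] The NE9 activity of record reads NE5's activity of record on footprints. -/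
@[simp] theorem actNE9_footprint {Bg : Type} {Pot : Type*} (oRec : ℕ → ℝ → Bg → Pot → OpDatum E)
    (iRec : ℕ → ℝ → Bg → Pot → Hist) (k : ℕ) (s : ℝ) (U : Bg) (Q : Pot) (Z : R.carriers.Dom) :
    actNE9 S oRec iRec k s U Q (footprint Z) = activity (b13InnerData R) S.act (k + 1) (oRec k s U Q) (iRec k s U Q) Z := by
  simp [actNE9, liftFam]

/-- [folklore] **THE `act` SLOT TYPED ONCE SERVES BOTH ROWS — AT THE NE9 READING OF RECORD.**  NE9's new term of `actNE9` on the
geometry of record at `(k, s, U, X, Q)` IS NE5's Kotecký–Preiss-form step output of record at the SOURCED operator datum and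
history, output scale `k + 1` — for every background slot `Bg` and table slot `Pot`. -/
theorem newTerm_actNE9 {Bg : Type} {Pot : Type*} (oRec : ℕ → ℝ → Bg → Pot → OpDatum E) (iRec : ℕ → ℝ → Bg → Pot → Hist)
    (k : ℕ) (s : ℝ) (U : Bg) (X : R.carriers.Dom) (Q : Pot) :
    (cubeChart R).geom.newTerm (actNE9 S oRec iRec) k s U X Q =
      (kpStep S E₀ cB).Out (k + 1) (oRec k s U Q) (iRec k s U Q) X := by
  unfold actNE9
  rw [newTerm_liftFam, kpStep_Out]
  unfold clusterSum
  exact Finset.sum_congr rfl fun K _ => (truncatedWeight_inc_eq_touchInc _ K).symm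

/-! ## §2 NE9's outer binder `Factorises` for NE5's functional of record at the BACKGROUND slot, under the data factorisation D-6 -/

/-- [folklore] **`Factorises` INHABITED AT THE BACKGROUND SLOT UNDER D-6.**  If on the window `W` run B's operator datum and
inserted history of record at output scale `k + 1` depend on the coupling sequence ONLY through the last coupling `g k` and the
table of earlier outputs `tableB (outB_KP S E₀ cB) g U` (displayed: `hop`, `hins` — the [dict] line D-6 asked of the substrate's
instance of record), then NE5's functional of record `outB_KP S E₀ cB` satisfies NE9's outer structural binder
`T4HistoryLipschitzOuter.Factorises` with background slot `R.carriers.BgB`, the `g`-independent channel `T k g H (U, Y) := H U Y`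
(the earlier table itself) and the new-term map read through `actNE9`.  Proof: `representsB_kp` (the causal recursion, hypothesis-free)
and §1. -/
theorem factorises_outB_KP_of_dataFactor {W : Set (ℕ → ℝ)}
    (oRec : ℕ → ℝ → R.carriers.BgB → (R.carriers.Dom → ℝ) → OpDatum E)
    (iRec : ℕ → ℝ → R.carriers.BgB → (R.carriers.Dom → ℝ) → Hist)
    (hop : ∀ g ∈ W, ∀ (U : R.carriers.BgB) (k : ℕ),
      (step S E₀ cB).opB g U (k + 1) = oRec k (g k) U (tableB (outB_KP S E₀ cB) g U))
    (hins : ∀ g ∈ W, ∀ (U : R.carriers.BgB) (k : ℕ),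
      (step S E₀ cB).insB g U (k + 1) (tableB (outB_KP S E₀ cB) g U) = iRec k (g k) U (tableB (outB_KP S E₀ cB) g U)) :
    Factorises (C := R.carriers) (ι := R.carriers.BgB × R.carriers.Dom) (outB_KP S E₀ cB) W (fun _ _ H p => H p.1 p.2)
      fun k s Q U X => ((cubeChart R).geom.newTerm (actNE9 S oRec iRec) k s U X (fun Y => Q (U, Y))).re := by
  intro g hg k U X hX
  have h := representsB_kp S E₀ cB W g hg U X
  rw [hX, kpStep_opB, kpStep_insB, hop g hg U k, hins g hg U k] at h
  dsimp only
  rw [newTerm_actNE9, h]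
  rfl

/-! ## §3 Why the slot reading matters: NE9 at a fixed datum says nothing at a fixed background -/

/-- A one-domain carrier (scale 1, tree length 0) with real «data» as both background types. [folklore] -/
def unitCarriers : Carriers where
  Dom := Unit
  scale := fun _ => 1
  d := fun _ => 0
  d_nonneg := fun _ => le_rfl
  BgA := ℝ
  BgB := ℝ
  gauge := fun _ _ => 0
  gauge_nonneg := fun _ _ => le_rfl
  transport := id

/-- The functional «read the datum»: no history dependence AT A FIXED DATUM. [folklore] -/
def readDatum : Functional unitCarriers ℝ := fun _ o _ => o

/-- [folklore] At a fixed datum, `readDatum` satisfies NE9 with ZERO history moduli. -/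
theorem ne9_readDatum (W : Set (ℕ → ℝ)) (κ : ℝ) : NE9 readDatum W κ (fun _ _ => 0) := by
  intro g _ g' _ U X
  simp [readDatum]

/-- The composite at a fixed BACKGROUND when the datum map jumps in `g 0` at the threshold `θ`. [folklore] -/
def jumpDatum (θ : ℝ) : Functional unitCarriers ℝ := fun g _ X => readDatum g (if g 0 ≤ θ then 0 else 1) X

/-- [folklore] **THE LOGICAL GAP, WITNESSED**: on the window `]0, γ]^ℕ` (`γ > 0`), the composite of the NE9-at-fixed-datum functional
`readDatum` (moduli ZERO) with a datum map that jumps at `g 0 = γ∕2` violates NE9 at the fixed background for EVERY modulus family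
`Λ`.  For Bałaban's step the datum map is `(g, U) ↦ opB g U k` (history-dependent potential species, [II] Lemma 2); its
history-regularity is exactly what the `OpDatum` reading of NE9 leaves unproved. -/
theorem not_ne9_of_datum_jump {γ : ℝ} (hγ : 0 < γ) (κ : ℝ) (Λ : ℕ → ℕ → ℝ) : ¬ NE9 (jumpDatum (γ / 2)) (Window γ) κ Λ := by
  intro h
  -- two histories differing only in `g 0`, on both sides of the threshold, at distance `ε`
  set M : ℝ := |Λ 1 0| + 1 with hM
  have hM0 : 0 < M := by positivity
  set ε : ℝ := min (γ / 2) (1 / (2 * M)) with hε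
  have hε0 : 0 < ε := lt_min (by linarith) (by positivity)
  have hεγ : ε ≤ γ / 2 := min_le_left _ _
  have hεM : ε ≤ 1 / (2 * M) := min_le_right _ _
  let g : ℕ → ℝ := fun _ => γ / 2
  let g' : ℕ → ℝ := fun i => if i = 0 then γ / 2 + ε else γ / 2
  have hg : g ∈ Window γ := fun i => ⟨by simp [g]; linarith, by simp [g]; linarith⟩
  have hg' : g' ∈ Window γ := by
    intro i
    by_cases hi : i = 0
    · simp [g', hi]; constructor <;> linarith
    · simp [g', hi]; constructor <;> linarith
  have h1 := h g hg g' hg' (0 : ℝ) ()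
  -- left side = 1, right side = Λ 1 0 * ε
  have hL : |jumpDatum (γ / 2) g 0 () - jumpDatum (γ / 2) g' 0 ()| = 1 := by
    have h2 : ¬ (γ / 2 + ε ≤ γ / 2) := by linarith
    simp [jumpDatum, readDatum, g, g', h2]
  have hR : Real.exp (-(κ * unitCarriers.d ())) *
      ∑ i ∈ Finset.range (unitCarriers.scale ()), Λ (unitCarriers.scale ()) i * |g i - g' i| = Λ 1 0 * ε := by
    simp [unitCarriers, g', g, abs_of_pos hε0]
  rw [hL, hR] at h1
  have h3 : Λ 1 0 * ε ≤ |Λ 1 0| * ε := mul_le_mul_of_nonneg_right (le_abs_self _) hε0.le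
  have h4 : |Λ 1 0| * ε ≤ |Λ 1 0| * (1 / (2 * M)) := mul_le_mul_of_nonneg_left hεM (abs_nonneg _)
  have h5 : |Λ 1 0| * (1 / (2 * M)) < 1 := by
    rw [mul_one_div, div_lt_one (by positivity)]
    linarith [abs_nonneg (Λ 1 0)]
  linarith

end Summit.QuantumFields.BalabanUV.T4Continuum.U3PolymerDictionaryNE9Face

end
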